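import Literature.NumberTheory.GaloisCohomology.Howard2004.TowerCasselsTatePairingOfDefectsProofs
import Literature.NumberTheory.GaloisCohomology.Howard2004.TowerCasselsTatePairingBalancedProofs
import Literature.NumberTheory.GaloisCohomology.Howard2004.TowerSelmerTransposeDualSelmerProofs
import Literature.NumberTheory.GaloisCohomology.Howard2004.PropagateTowerProofs
import Literature.NumberTheory.GaloisRepresentations.LocalGlobalCohomologyDualityProofs
import Literature.Algebra.Module.ZModSocleReadingProofs
import HarnessLib

/-!
# Howard 2004, Prop. 1.4.1 / Thm. 1.4.2 on classes: the `ℤ/p`-valued LEFT-KERNEL tower pairing of a full setting from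
# the class-level Cassels–Tate pairing and its four P-level letters (proofs file, brick «C451-CL Q7b ASSEMBLY FROM LETTERS»)

Topic `NumberTheory/GaloisCohomology/Howard2004`. THEOREMS ONLY: no definition, no named fact, no instance, no notation,
no `sorry`.  Cell `pub/bsd-print-x9` (seat `bsd-line-x10b-p1` LEAD g14, `--supports stmt-BirchSwinnertonDyer-22642`).

WHAT IS PROVED.  **`DVRSetting.exists_towerZModLeftKernelPairing_of_letters`** — on a `DVRSetting` with H.0–H.5,
`p ∤ #𝓞_K^×`, `e₀ = 1`, a level `t`, `n ⊆ 𝓛^{(t+1)}`, a presentation `ι` of `ker red_{t+1→t}` with cartesian conditions, ONE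
level `p^{k+1}` of local duality with a family `inv` (`SelmerComplement`, reciprocity), global lifts (`hlift`), the class-level
pairing `P` of `TowerCasselsTatePairingOfDefectsProofs` with its value clause `hP`, and a DUAL SLOT
`e₀ : H¹_{𝓕(n)}(K, T^{(0)}) ≃ H¹_{𝓕(n)_0^*}(K, (T^{(0)})^D)` with its scalar law (`DualSelmerTransferScalarsProofs`): GIVEN the two
P-level letters (RIGHT-P) `P a (e₀ (red_{t+1→0} z)) = 0` for `z ∈ H¹_{𝓕(n)}(K, T^{(t+1)})` and (SKEW-P)
`P a (e₀ (red^t b)) + P b (e₀ (red^t a)) = 0`, there is a bi-additive `R`-BALANCED `ℤ/p`-valued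
`Q : H¹_{𝓕(n)}(K, T^{(t)}) × H¹_{𝓕(n)}(K, T^{(0)}) → ℤ/p` with LEFT kernel `= range H¹(red_{t+1→t})`, killing
`range H¹(red_{t+1→0})` on the right, and skew — EXACTLY the per-`(k, n, t)` clause of
`prop141_casselsTate_skewPairing_atLevel_printIntended_of_forall_full_towerZModLeftKernelPairings`.
Construction: `Q′ a w := P a (e₀ w)` is killed by `p` (`T̄^D` is `p`-torsion), read in `ℤ/p` through the socle
`j : ℤ/p ↪ ℤ/p^{k+1}` (`exists_zmod_reading_of_prime_smul_eq_zero`); balance from `towerCasselsTatePairing_balanced` + the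
scalar law of `e₀`; left kernel from `forall_towerCasselsTatePairing_eq_zero_iff` + `e₀` onto; the other two from the letters.

HONEST FRAMING: the letters, the lifts and the data are hypotheses here; Prop. 1.4.1, Thm. 1.4.2, C45.1′/C45.1″ and
`thm161_dvrKolyvaginBound` are NOT proved; no summit statement is proved; the Birch–Swinnerton-Dyer conjecture is not proved by
any of this.

References: [Howard2004HeegnerKolyvagin] Prop. 1.4.1 and Thm. 1.4.2 (proof, displays (i)(ii)) (arXiv:1202.6340 p0008 L83–L142),
§1.6 ¶1 (p0011 L33–44); [Flach1990] Thm. 1, Thm. 2; [MorganSmith2021CTP] Thm. 1.3, Prop. 3.5, Thm. 3.7, Rem. 6.3;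
[MilneADT2006] Ch. I §0, Thm. 4.10.
-/

set_option autoImplicit false

noncomputable section

namespace Literature.NumberTheory.GaloisCohomology.Howard2004

open Function NumberField IsDedekindDomain Field CategoryTheory
open scoped NumberField ContRepresentation
open Literature.NumberTheory.GaloisRepresentations
open Literature.NumberTheory.GaloisRepresentations.DiscreteGaloisModule
open Literature.NumberTheory.GaloisCohomology (LocalInvariants)

namespace DVRSetting

variable {p : ℕ} [Fact p.Prime] {K : Type} [Field K] [NumberField K]
  {R : Type} [CommRing R] [IsDomain R] [IsDiscreteValuationRing R] [Algebra ℤ_[p] R]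
  {N : ℕ → Type} [∀ k, AddCommGroup (N k)] [∀ k, TopologicalSpace (N k)]
  [∀ k, DiscreteTopology (N k)] [∀ k, Module R (N k)]
  {Rk : ℕ → Type} [∀ k, CommRing (Rk k)] [∀ k, IsLocalRing (Rk k)] [∀ k, TopologicalSpace (Rk k)]
  [∀ k, DiscreteTopology (Rk k)] [∀ k, Algebra ℤ_[p] (Rk k)] [∀ k, Algebra R (Rk k)]
  [∀ k, Module (Rk k) (N k)] [∀ k, IsScalarTower R (Rk k) (N k)]
  {Nbar : Type} [AddCommGroup Nbar] [TopologicalSpace Nbar] [DiscreteTopology Nbar]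
  [∀ k, Module (Rk k) Nbar]
  {Nq : ℕ → Finset (HeightOneSpectrum (𝓞 K)) → Type} [∀ k n, AddCommGroup (Nq k n)]
  [∀ k n, TopologicalSpace (Nq k n)] [∀ k n, DiscreteTopology (Nq k n)]
  [∀ k n, Module (Rk k) (Nq k n)] [∀ k n, Module R (Nq k n)]
  [∀ k n, IsScalarTower R (Rk k) (Nq k n)]

/-- **The `ℤ/p`-valued left-kernel tower pairing from the class-level Cassels–Tate pairing and its letters** (see the module
docstring). [cite: Howard2004HeegnerKolyvagin, Prop. 1.4.1 and Thm. 1.4.2 (proof, displays (i)(ii)) (arXiv:1202.6340 p0008 L83–L142)]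
[cite: MorganSmith2021CTP, Thm. 1.3, Prop. 3.5, Thm. 3.7 and Rem. 6.3] [cite: MilneADT2006, Ch. I §0 and Thm. 4.10] -/
theorem exists_towerZModLeftKernelPairing_of_letters (S : DVRSetting p K R N Rk Nbar Nq) [∀ j, Finite (N j)]
    (hy : S.SatisfiesH) (hu : ¬ p ∣ Nat.card (𝓞 K)ˣ) (he0 : S.e 0 = 1) {t : ℕ}
    {n : Finset (HeightOneSpectrum (𝓞 K))} (hn : ↑n ⊆ S.levelPrimes (t + 1)) (ι : N 0 →ₗ[R] N (t + 1))
    (hιg : ∀ (g : absoluteGaloisGroup K) (x : N 0), ι (S.T.ρ 0 g x) = S.T.ρ (t + 1) g (ι x))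
    (hιinj : Function.Injective ι) (hιex : ∀ y : N (t + 1), S.T.redLE (Nat.le_succ t) y = 0 ↔ ∃ x, ι x = y)
    (hιF : ∀ (v : Place K) (m : galoisCohomology ((S.T.ρ 0).toLocal v) 1),
      ContinuousRep.cohomologyMap ((S.T.ρ 0).toLocal v) ((S.T.ρ (t + 1)).toLocal v) ι.toAddMonoidHom
          continuous_of_discreteTopology (fun _ x => hιg _ x) 1 m ∈ ((S.t (t + 1)).atLevel S.jbar n).cond v ↔
        m ∈ ((S.t 0).atLevel S.jbar n).cond v)
    {k₀ : ℕ} (inv : LocalInvariants K (p ^ (k₀ + 1))) (hSC : inv.SelmerComplement) (hPT : inv.SumLocalTermEqZero)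
    (hn0S : ∀ v : HeightOneSpectrum (𝓞 K), (Sum.inr v : Place K) ∉ S.Sigma →
      ((p ^ (k₀ + 1) : ℕ) : 𝓞 K) ∉ v.asIdeal ∧ GaloisRep.IsUnramifiedAt v (S.T.ρ 0))
    (hlift : ∀ a ∈ (((S.t t).atLevel S.jbar n).cond).selmerGroup,
      ∃ ã : galoisCohomology (S.T.ρ (t + 1)) 1, S.redLEH1 (Nat.le_succ t) ã = a)
    (P : ↥(((S.t t).atLevel S.jbar n).cond).selmerGroup →+
        ↥(inv.dualSelmerStructure (S.T.ρ 0) ((S.t 0).atLevel S.jbar n).cond).selmerGroup →+ ZMod (p ^ (k₀ + 1)))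
    (hP : ∀ (a : ↥(((S.t t).atLevel S.jbar n).cond).selmerGroup) (ã : galoisCohomology (S.T.ρ (t + 1)) 1)
        (_ : S.redLEH1 (Nat.le_succ t) ã = a) (m : ∀ v : Place K, galoisCohomology ((S.T.ρ 0).toLocal v) 1)
        (_ : ∀ v, ∃ ℓ ∈ ((S.t (t + 1)).atLevel S.jbar n).cond v,
          galoisCohomology.localization (S.T.ρ (t + 1)) v 1 ã - ℓ =
            ContinuousRep.cohomologyMap ((S.T.ρ 0).toLocal v) ((S.T.ρ (t + 1)).toLocal v) ι.toAddMonoidHom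
              continuous_of_discreteTopology (fun _ x => hιg _ x) 1 (m v))
        (Sfin : Finset (Place K)) (_ : ∀ v ∉ Sfin, m v = 0)
        (y : ↥(inv.dualSelmerStructure (S.T.ρ 0) ((S.t 0).atLevel S.jbar n).cond).selmerGroup),
        P a y = ∑ v ∈ Sfin, localTatePairingZMod (S.T.ρ 0) (p ^ (k₀ + 1)) v (inv v) (m v)
          (galoisCohomology.localization ((S.T.ρ 0).tateDual (p ^ (k₀ + 1))) v 1 y))
    -- the dual slot at level `0` with its scalar law
    (e₀ : letI := galoisCohomology.moduleH1 (S.T.ρ 0) (S.T.hlin 0)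
      ↥(S.selmerModuleAt hy 0 n) ≃+ ↥(inv.dualSelmerStructure (S.T.ρ 0) ((S.t 0).atLevel S.jbar n).cond).selmerGroup)
    (he₀ : letI := galoisCohomology.moduleH1 (S.T.ρ 0) (S.T.hlin 0)
      ∀ (r : R) (c : ↥(S.selmerModuleAt hy 0 n)),
        ((e₀ (r • c) : ↥(inv.dualSelmerStructure (S.T.ρ 0) ((S.t 0).atLevel S.jbar n).cond).selmerGroup) :
          galoisCohomology ((S.T.ρ 0).tateDual (p ^ (k₀ + 1))) 1) =
        ContinuousRep.cohomologyMap ((S.T.ρ 0).tateDual (p ^ (k₀ + 1))) ((S.T.ρ 0).tateDual (p ^ (k₀ + 1)))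
          (pairingDualHom (p ^ (k₀ + 1)) ((tateDualEval K (N 0) (p ^ (k₀ + 1))).comp (DistribSMul.toAddMonoidHom (N 0) r)))
          continuous_of_discreteTopology
          (pairingDualHom_smul (pairing_comp_smul (S.T.ρ 0) (S.T.ρ 0) (p ^ (k₀ + 1)) (DistribSMul.toAddMonoidHom (N 0) r)
            (fun g y => (S.T.hlin 0 g r y).symm))) 1
          ((e₀ c : ↥(inv.dualSelmerStructure (S.T.ρ 0) ((S.t 0).atLevel S.jbar n).cond).selmerGroup) :
            galoisCohomology ((S.T.ρ 0).tateDual (p ^ (k₀ + 1))) 1))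
    -- the two P-level letters
    (hRIGHT : letI := galoisCohomology.moduleH1 (S.T.ρ 0) (S.T.hlin 0);
      letI := galoisCohomology.moduleH1 (S.T.ρ (t + 1)) (S.T.hlin (t + 1));
      ∀ (a : ↥(((S.t t).atLevel S.jbar n).cond).selmerGroup) (z : ↥(S.selmerModuleAt hy (t + 1) n)),
        P a (e₀ (S.redSelLE hy (Nat.zero_le (t + 1)) n z)) = 0)
    (hSKEW : letI := galoisCohomology.moduleH1 (S.T.ρ t) (S.T.hlin t);
      letI := galoisCohomology.moduleH1 (S.T.ρ 0) (S.T.hlin 0);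
      ∀ (a b : ↥(S.selmerModuleAt hy t n)),
        P ⟨a.1, a.2⟩ (e₀ (S.redSelLE hy (Nat.zero_le t) n b)) + P ⟨b.1, b.2⟩ (e₀ (S.redSelLE hy (Nat.zero_le t) n a)) = 0) :
    ∃ Q : ↥(S.selmerModuleAt hy t n) →+ ↥(S.selmerModuleAt hy 0 n) →+ ZMod p,
      (letI := galoisCohomology.moduleH1 (S.T.ρ t) (S.T.hlin t);
        letI := galoisCohomology.moduleH1 (S.T.ρ 0) (S.T.hlin 0);
        ∀ (r : R) (a : ↥(S.selmerModuleAt hy t n)) (w : ↥(S.selmerModuleAt hy 0 n)), Q (r • a) w = Q a (r • w)) ∧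
      (letI := galoisCohomology.moduleH1 (S.T.ρ t) (S.T.hlin t);
        letI := galoisCohomology.moduleH1 (S.T.ρ (t + 1)) (S.T.hlin (t + 1));
        ∀ a : ↥(S.selmerModuleAt hy t n), (∀ w, Q a w = 0) ↔
          a ∈ LinearMap.range (S.redSelLE hy (Nat.le_succ t) n)) ∧
      (letI := galoisCohomology.moduleH1 (S.T.ρ 0) (S.T.hlin 0);
        letI := galoisCohomology.moduleH1 (S.T.ρ (t + 1)) (S.T.hlin (t + 1));
        ∀ (z : ↥(S.selmerModuleAt hy (t + 1) n)) (a : ↥(S.selmerModuleAt hy t n)),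
          Q a (S.redSelLE hy (Nat.zero_le (t + 1)) n z) = 0) ∧
      (letI := galoisCohomology.moduleH1 (S.T.ρ t) (S.T.hlin t);
        letI := galoisCohomology.moduleH1 (S.T.ρ 0) (S.T.hlin 0);
        ∀ a b : ↥(S.selmerModuleAt hy t n),
          Q a (S.redSelLE hy (Nat.zero_le t) n b) = - Q b (S.redSelLE hy (Nat.zero_le t) n a)) := by
  classical
  letI modt : Module R (galoisCohomology (S.T.ρ t) 1) := galoisCohomology.moduleH1 (S.T.ρ t) (S.T.hlin t)
  letI mod0 : Module R (galoisCohomology (S.T.ρ 0) 1) := galoisCohomology.moduleH1 (S.T.ρ 0) (S.T.hlin 0)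
  letI mods : Module R (galoisCohomology (S.T.ρ (t + 1)) 1) :=
    galoisCohomology.moduleH1 (S.T.ρ (t + 1)) (S.T.hlin (t + 1))
  haveI : NeZero (p ^ (k₀ + 1)) := ⟨pow_ne_zero _ (Fact.out : p.Prime).ne_zero⟩
  -- `T̄` and `T̄^D` are `p`-torsion
  have hpN0 : ∀ x : N 0, p • x = 0 := fun x ↦ by
    rw [← Nat.cast_smul_eq_nsmul R]
    refine hy.killed 0 _ ?_ x
    rw [he0, pow_one]
    exact S.natCast_p_mem_maximalIdeal hy
  have hMD : ∀ f : TateDual K (N 0) (p ^ (k₀ + 1)), p • f = 0 := fun f ↦ TateDual.ext fun m ↦ by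
    change p • f m = 0
    rw [← map_nsmul, hpN0 m, map_zero]
  -- the engine's module `𝓗_t(n)` has the Selmer group as underlying subgroup (`mem_selmerModuleAt_iff`)
  let incl : ↥(S.selmerModuleAt hy t n) ≃+ ↥(((S.t t).atLevel S.jbar n).cond).selmerGroup :=
    { toFun := fun c ↦ ⟨c.1, c.2⟩
      invFun := fun c ↦ ⟨c.1, c.2⟩
      left_inv := fun _ ↦ rfl
      right_inv := fun _ ↦ rfl
      map_add' := fun _ _ ↦ rfl }
  have hincl : ∀ c : ↥(S.selmerModuleAt hy t n), incl c = ⟨c.1, c.2⟩ := fun _ ↦ rfl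
  -- the `ℤ/p^{k+1}`-valued pairing on the engine's modules
  let Q' : ↥(S.selmerModuleAt hy t n) →+ ↥(S.selmerModuleAt hy 0 n) →+ ZMod (p ^ (k₀ + 1)) :=
    (P.comp incl.toAddMonoidHom).compl₂ e₀.toAddMonoidHom
  have hQ' : ∀ (a : ↥(S.selmerModuleAt hy t n)) (w : ↥(S.selmerModuleAt hy 0 n)), Q' a w = P ⟨a.1, a.2⟩ (e₀ w) :=
    fun _ _ ↦ rfl
  have hQ'p : ∀ a w, p • Q' a w = 0 := fun a w ↦ by
    rw [hQ', ← map_nsmul]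
    have h0 : p • e₀ w = 0 := Subtype.ext (by
      rw [AddSubgroupClass.coe_nsmul, ZeroMemClass.coe_zero]
      exact galoisCohomology.nsmul_eq_zero_of_forall _ hMD _)
    rw [h0, map_zero]
  obtain ⟨Q, j, hj, hjQ⟩ := Literature.Algebra.Module.exists_zmod_reading_of_prime_smul_eq_zero p k₀ Q' hQ'p
  have hQ0 : ∀ a w, Q a w = 0 ↔ P ⟨a.1, a.2⟩ (e₀ w) = 0 := fun a w ↦ by
    rw [← hQ', ← hjQ, ← map_zero j]
    exact ⟨fun h ↦ by rw [h], fun h ↦ hj h⟩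
  refine ⟨Q, ?_, ?_, ?_, ?_⟩
  · -- BALANCE: `P (r•a) (e₀ w) = P a (e₀ (r•w))`
    intro r a w
    apply hj
    rw [hjQ, hjQ, hQ', hQ']
    refine S.towerCasselsTatePairing_balanced hy hu (Nat.le_succ t) hn ι hιg hιinj hιex inv hlift P hP r
      ⟨a.1, a.2⟩ ⟨(r • a).1, (r • a).2⟩ rfl (e₀ w) (e₀ (r • w)) ?_
    rw [he₀ r w]
    exact cohomologyMap_one_congr_apply _ _ _ _ _ _ (fun f ↦ TateDual.ext fun x ↦ rfl) _
  · -- LEFT KERNEL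
    intro a
    have hQ3 := S.forall_towerCasselsTatePairing_eq_zero_iff hy hu (Nat.le_succ t) hn ι hιg hιinj hιex hιF
      (fun x ↦ by rw [pow_succ, mul_smul, hpN0, smul_zero]) inv hSC hPT hn0S hlift P hP ⟨a.1, a.2⟩
    constructor
    · intro h
      have h' : ∀ y, P ⟨a.1, a.2⟩ y = 0 := fun y ↦ by
        obtain ⟨w, rfl⟩ := e₀.surjective y
        exact (hQ0 a w).1 (h w)
      obtain ⟨z, hz, hza⟩ := hQ3.1 h'
      exact ⟨⟨z, hz⟩, Subtype.ext hza⟩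
    · rintro ⟨z, hza⟩ w
      refine (hQ0 a w).2 (hQ3.2 ⟨z.1, z.2, ?_⟩ _)
      rw [← hza]
      rfl
  · -- RIGHT ⊆
    intro z a
    exact (hQ0 a _).2 (hRIGHT ⟨a.1, a.2⟩ z)
  · -- SKEW
    intro a b
    rw [eq_neg_iff_add_eq_zero]
    apply hj
    rw [map_add, hjQ, hjQ, map_zero, hQ', hQ']
    exact hSKEW a b

end DVRSetting

end Literature.NumberTheory.GaloisCohomology.Howard2004

end
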